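/-
Copyright: statement-level skeleton of a published paper (lit-balaban cell, Phase-2 proof seat p39 gen 4). No proof claims
beyond what the kernel checks below.
-/
import Literature.MathematicalPhysics.QuantumFieldTheory.Balaban1983to89.B3CxiDifferenceKernel

/-!
# B3 — T. Bałaban, *(Higgs)₂,₃ quantum fields in a finite volume. III. Renormalization*, CMP **88** (1983) 411–445
[Balaban1983Higgs3], p. 437: the printed clause *"and the corresponding inequalities for derivatives"* for the free propagator
C^ξ = (−Δ^ξ+1)^{−1} on ξℤ³ — FILE 3/3: ASSEMBLY (d = 3), **|∂^ξ_ν C^ξ(y)| ≤ O(1)·e^{−½ξ|y|}/(ξ|y|)²** uniformly in 0 < ξ ≤ 1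

statement-level skeleton of published theorems with citation tags; proofs where landed; nothing here is a claim about
the Yang–Mills mass gap

PDF held: `paper:balaban1983-higgs-2-3-quantum-fields-finite-volume` (journal page = PDF page + 410), p. 437 [PDF 27].
WHAT IS REPRODUCED: a member of row **B3.Eq3.11-3.17** of `HOME/lit-balaban-r15/ROWS-B3.md` (reader/typer r15, fold owner of
B3) — the p. 437 sentence *"Using the inequalities |C^ξ(y − y′)| ≦ O(1)e^{−½|y−y′|}/|y − y′|, |G^ξ_{j″}(0; y, y′)| ≦
O(1)e^{−δ₀|y−y′|}/|y − y′|, and the corresponding inequalities for derivatives, we can estimate (3.16) by a constant"* — here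
the DERIVATIVE INEQUALITY FOR THE FREE PROPAGATOR C^ξ of the ξ-lattice (r15's momentum integral `B3Sect3VectorSelfEnergy.Cxi 3 ξ y`,
y ∈ ℤ³ the integer label of the lattice point ξy; lattice derivatives `pdiffZ ξ⁻¹ ν` = ∂^ξ_ν, `pdiffAdjZ ξ⁻¹ ν` = ∂^{ξ*}_ν of the
same file), PROVED WITH EXPLICIT CONSTANTS AND UNIFORMLY IN THE LATTICE SPACING: **for 0 < ξ ≤ 1, 0 ≠ y ∈ ℤ³ and every ν,
|(∂^ξ_νC^ξ)(y)| = ξ⁻¹|C^ξ(y+e_ν) − C^ξ(y)| ≤ 14400·e^{−ξ|y|/2}/(ξ|y|)²**, |y| = (Σ_μ y_μ²)^{1/2} (`abs_pdiffZ_Cxi_three_le`; the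
same for ∂^{ξ*}_ν, `abs_pdiffAdjZ_Cxi_three_le`; sup-norm forms with the constant 900, `abs_pdiffZ_Cxi_three_le_sup` /
`abs_pdiffAdjZ_Cxi_three_le_sup` — the shape `B′·((ξ·supDist)²)⁻¹·e^{−δ·ξ·supDist}` (δ = ½) in which `B3Bound316.abs_bracket316_le`
takes "the corresponding inequalities for derivatives" as its hypothesis `hM`, for the C^ξ-factor of the kernel M there).
Unit `lit-balaban-p39-g4` (Phase-2 proof seat p39, gen 4), HOME `run/shared/lean/pub/lit-balaban/`.  The paper prints no proof
(it refers to its general propagator estimates (2.10)–(2.12)); the proof here continues this seat's gen-3 heat-kernel proof of the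
undifferentiated bound (`B3CxiUniformBound.Cxi_three_le`, O(1) = 140): file 1 `B3CxiBesselDifference` (the tilted bound for the
discrete derivative of the one-dimensional kernel), file 2 `B3CxiDifferenceKernel` (the pointwise bound
`abs_integrand_succ_sub_three_le` of the difference integrand e^{−t}[Q(θt)(y+e_ν) − Q(θt)(y)] of
C^ξ(y+e_ν) − C^ξ(y) = θξ²ξ^{−3}∫₀^∞e^{−t}[Q(θt)(y+e_ν) − Q(θt)(y)]dt, θ = (6+ξ²)^{−1}:
≤ e^{−ξ|y|/2}[10(θt)^{−2} + (64/7)|y_ν|(θt)^{−5/2}]e^{−(|y|²/14)/(θt)} + 8e^{−|y|_∞}(2/√(1+θt))³), and this file: (§4) the t-integrals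
∫₀^∞u^{−p}e^{−q/u}du = q^{1−p}Γ(p−1) (substitution u = x^{−1} to Mathlib's Gamma integral `Real.integral_rpow_mul_exp_neg_mul_Ioi`;
p = 2: 1/q, p = 5/2: q^{−3/2}√π/2, q = |y|²/14), giving 10θ^{−1}·14/|y|² = 140θ^{−1}/|y|², (64/7)|y_ν|θ^{−1}(14/|y|²)^{3/2}√π/2 =
64√(14π)|y_ν|θ^{−1}/|y|³ ≤ 448θ^{−1}/|y|², and 8·16θ^{−1}e^{−|y|_∞} ≤ 128·107·θ^{−1}e^{−|y|/2}/|y|² (4|y| ≤ 7|y|_∞, |y|²e^{−|y|/14} ≤ 107);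
(§5) with the prefactor θξ²ξ^{−3}·θ^{−1} = ξ^{−1}: |C^ξ(y+e_ν) − C^ξ(y)| ≤ (140 + 448 + 13696)ξ^{−1}e^{−ξ|y|/2}/|y|² ≤ 14400·ξ^{−1}e^{−ξ|y|/2}/|y|²
(`abs_Cxi_succ_sub_three_le`), i.e. the displayed bound after division by ξ; in the sup norm the last term is 128·(16/e²)e^{−|y|_∞/2}/|y|_∞²
and the constant is 140 + 448 + 278 ≤ 900.  Mathlib + the cited tree files only; no new definitions; no named facts.
-/

open scoped BigOperators Topology
open Real MeasureTheory Set Filter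

namespace Literature.MathematicalPhysics.QuantumFieldTheory.Balaban1983to89.B3CxiDerivativeBound

open B3Sect3VectorSelfEnergy B3CxiPropagator B3CxiBesselKernel B3CxiPoissonization B3CxiUniformBound B3CxiBesselDifference
  B3CxiDifferenceKernel

noncomputable section

variable {d : ℕ} {ξ : ℝ}

/-- kernel: θ = (6+ξ²)^{−1} > 0. [folklore] -/
private theorem theta3_pos (hξ : 0 < ξ) : 0 < hopWeight 3 ξ := by
  unfold hopWeight; positivity

/-! ## 4. The t-integrals: ∫₀^∞ u^{−p}e^{−q/u} du = (1/q)^{p−1}Γ(p−1) (u = x^{−1} to Mathlib's Gamma integral) -/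

/-- kernel: the substitution u = x^{−1}: (|−1|x^{−2})·(u^{−p}e^{−q/u})|_{u=x^{−1}} = x^{p−2}e^{−qx} for x > 0. [folklore] -/
private theorem subst_identity (p q : ℝ) {x : ℝ} (hx : 0 < x) :
    (|(-1 : ℝ)| * x ^ ((-1 : ℝ) - 1)) • ((x ^ (-1 : ℝ)) ^ (-p) * Real.exp (-q / x ^ (-1 : ℝ)))
      = x ^ (p - 2) * Real.exp (-(q * x)) := by
  have h1 : (x ^ (-1 : ℝ)) ^ (-p) = x ^ p := by
    rw [← Real.rpow_mul hx.le]; norm_num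
  have h2 : x ^ ((-1 : ℝ) - 1) * x ^ p = x ^ (p - 2) := by
    rw [← Real.rpow_add hx]; norm_num; ring_nf
  have h3 : -q / x ^ (-1 : ℝ) = -(q * x) := by
    rw [Real.rpow_neg_one, div_inv_eq_mul, neg_mul]
  rw [smul_eq_mul, h1, h3, abs_neg, abs_one, one_mul, ← mul_assoc, h2]

/-- kernel: for p > 1 and q > 0, ∫₀^∞ u^{−p}e^{−q/u} du = (1/q)^{p−1}Γ(p−1) and the integrand is integrable on (0,∞)
(substitution u = x^{−1} to `Real.integral_rpow_mul_exp_neg_mul_Ioi`). [cite: Balaban1983Higgs3, (3.16) p.437] -/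
theorem integral_rpow_neg_exp_neg_div {p q : ℝ} (hp : 1 < p) (hq : 0 < q) :
    IntegrableOn (fun u : ℝ => u ^ (-p) * Real.exp (-q / u)) (Ioi 0) ∧
    ∫ u in Ioi (0 : ℝ), u ^ (-p) * Real.exp (-q / u) = (1 / q) ^ (p - 1) * Real.Gamma (p - 1) := by
  set g : ℝ → ℝ := fun u => u ^ (-p) * Real.exp (-q / u) with hg
  have hcongr : EqOn (fun x : ℝ => (|(-1 : ℝ)| * x ^ ((-1 : ℝ) - 1)) • g (x ^ (-1 : ℝ)))
      (fun x => x ^ (p - 2) * Real.exp (-(q * x))) (Ioi 0) := fun x hx => subst_identity p q hx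
  have hG : IntegrableOn (fun x : ℝ => x ^ (p - 2) * Real.exp (-(q * x))) (Ioi 0) := by
    have h := integrableOn_rpow_mul_exp_neg_mul_rpow (s := p - 2) (p := 1) (b := q) (by linarith) le_rfl hq
    refine h.congr_fun (fun x hx => ?_) measurableSet_Ioi
    simp only [Real.rpow_one, neg_mul]
  have hint : IntegrableOn g (Ioi 0) := by
    rw [← integrableOn_Ioi_comp_rpow_iff g (p := -1) (by norm_num)]
    exact hG.congr_fun hcongr.symm measurableSet_Ioi
  refine ⟨hint, ?_⟩
  rw [← integral_comp_rpow_Ioi g (p := -1) (by norm_num), setIntegral_congr_fun measurableSet_Ioi hcongr]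
  have h := Real.integral_rpow_mul_exp_neg_mul_Ioi (a := p - 1) (r := q) (by linarith) hq
  rw [show p - 1 - 1 = p - 2 by ring] at h
  exact h

/-- kernel: ∫₀^∞ u^{−2}e^{−q/u} du = 1/q (q > 0). [cite: Balaban1983Higgs3, (3.16) p.437] -/
theorem integral_rpow_neg_two_exp {q : ℝ} (hq : 0 < q) :
    IntegrableOn (fun u : ℝ => u ^ (-(2 : ℝ)) * Real.exp (-q / u)) (Ioi 0) ∧
    ∫ u in Ioi (0 : ℝ), u ^ (-(2 : ℝ)) * Real.exp (-q / u) = 1 / q := by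
  obtain ⟨h1, h2⟩ := integral_rpow_neg_exp_neg_div (p := 2) (by norm_num) hq
  refine ⟨h1, ?_⟩
  rw [h2, show (2 : ℝ) - 1 = 1 by norm_num, Real.rpow_one, Real.Gamma_one, mul_one]

/-- kernel: ∫₀^∞ u^{−5/2}e^{−q/u} du = (1/q)^{3/2}·(√π/2) (q > 0; Γ(3/2) = ½Γ(½) = √π/2). [cite: Balaban1983Higgs3, (3.16) p.437] -/
theorem integral_rpow_neg_five_halves_exp {q : ℝ} (hq : 0 < q) :
    IntegrableOn (fun u : ℝ => u ^ (-(5 / 2 : ℝ)) * Real.exp (-q / u)) (Ioi 0) ∧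
    ∫ u in Ioi (0 : ℝ), u ^ (-(5 / 2 : ℝ)) * Real.exp (-q / u) = (1 / q) ^ (3 / 2 : ℝ) * (Real.sqrt Real.pi / 2) := by
  obtain ⟨h1, h2⟩ := integral_rpow_neg_exp_neg_div (p := 5 / 2) (by norm_num) hq
  refine ⟨h1, ?_⟩
  rw [h2, show (5 / 2 : ℝ) - 1 = 3 / 2 by norm_num, show (3 / 2 : ℝ) = 1 / 2 + 1 by norm_num,
    Real.Gamma_add_one (by norm_num), Real.Gamma_one_half_eq]
  ring

/-! ## 5. Assembly: |C^ξ(y+e_ν) − C^ξ(y)| ≤ 14400·ξ⁻¹e^{−ξ|y|/2}/|y|² on ξℤ³ (0 < ξ ≤ 1, y ≠ 0), and the derivative bounds -/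

/-- kernel: R²·e^{−R/14} ≤ 107 for R ≥ 0 (e·R/28 ≤ e^{R/28}, squared; 784/e² ≤ 107). [folklore] -/
private theorem sq_mul_exp_neg_div_fourteen_le {R : ℝ} (hR : 0 ≤ R) : R ^ 2 * Real.exp (-(R / 14)) ≤ 107 := by
  have h1 : Real.exp 1 * (R / 28) ≤ Real.exp (R / 28) := by
    have h := Real.add_one_le_exp (R / 28 - 1)
    rw [Real.exp_sub, le_div_iff₀ (Real.exp_pos 1)] at h
    linarith
  have h0 : 0 ≤ Real.exp 1 * (R / 28) := by positivity
  have h2 : (Real.exp 1 * (R / 28)) ^ 2 ≤ Real.exp (R / 28) ^ 2 := pow_le_pow_left₀ h0 h1 2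
  have h3 : Real.exp (R / 28) ^ 2 = Real.exp (R / 14) := by rw [← Real.exp_nat_mul]; ring_nf
  rw [h3] at h2
  have he : 7.389 ≤ Real.exp 1 ^ 2 := by nlinarith [Real.exp_one_gt_d9, Real.exp_pos 1]
  have h4 : Real.exp 1 ^ 2 * R ^ 2 ≤ 784 * Real.exp (R / 14) := by nlinarith [h2]
  have h5 : R ^ 2 * Real.exp (-(R / 14)) * Real.exp 1 ^ 2 ≤ 784 := by
    rw [Real.exp_neg]
    have hpos := Real.exp_pos (R / 14)
    calc R ^ 2 * (Real.exp (R / 14))⁻¹ * Real.exp 1 ^ 2 = (Real.exp 1 ^ 2 * R ^ 2) / Real.exp (R / 14) := by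
          field_simp
      _ ≤ 784 * Real.exp (R / 14) / Real.exp (R / 14) := div_le_div_of_nonneg_right h4 hpos.le
      _ = 784 := by field_simp
  nlinarith [h5, he, Real.exp_pos (-(R / 14)), sq_nonneg R]

/-- kernel: N²·e^{−N/2} ≤ 2.17 for N ≥ 0 (e·N/4 ≤ e^{N/4}, squared; 16/e² ≤ 2.17). [folklore] -/
private theorem sq_mul_exp_neg_half_le {N : ℝ} (hN : 0 ≤ N) : N ^ 2 * Real.exp (-(N / 2)) ≤ 2.17 := by
  have h1 : Real.exp 1 * (N / 4) ≤ Real.exp (N / 4) := by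
    have h := Real.add_one_le_exp (N / 4 - 1)
    rw [Real.exp_sub, le_div_iff₀ (Real.exp_pos 1)] at h
    linarith
  have h0 : 0 ≤ Real.exp 1 * (N / 4) := by positivity
  have h2 : (Real.exp 1 * (N / 4)) ^ 2 ≤ Real.exp (N / 4) ^ 2 := pow_le_pow_left₀ h0 h1 2
  have h3 : Real.exp (N / 4) ^ 2 = Real.exp (N / 2) := by rw [← Real.exp_nat_mul]; ring_nf
  rw [h3] at h2
  have he : 7.389 ≤ Real.exp 1 ^ 2 := by nlinarith [Real.exp_one_gt_d9, Real.exp_pos 1]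
  have h4 : Real.exp 1 ^ 2 * N ^ 2 ≤ 16 * Real.exp (N / 2) := by nlinarith [h2]
  have h5 : N ^ 2 * Real.exp (-(N / 2)) * Real.exp 1 ^ 2 ≤ 16 := by
    rw [Real.exp_neg]
    have hpos := Real.exp_pos (N / 2)
    calc N ^ 2 * (Real.exp (N / 2))⁻¹ * Real.exp 1 ^ 2 = (Real.exp 1 ^ 2 * N ^ 2) / Real.exp (N / 2) := by
          field_simp
      _ ≤ 16 * Real.exp (N / 2) / Real.exp (N / 2) := div_le_div_of_nonneg_right h4 hpos.le
      _ = 16 := by field_simp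
  nlinarith [h5, he, Real.exp_pos (-(N / 2)), sq_nonneg N]

/-- kernel: the t-integral of the absolute difference of the Poissonized integrands (y ≠ 0, μ₀ a largest coordinate, θ = (6+ξ²)^{−1},
q = R²/14): ∫₀^∞|e^{−t}ΔQ(θt)(y)|dt ≤ e^{−ξR/2}·[10θ^{−1}q^{−1} + (64/7)|y_ν|θ^{−1}q^{−3/2}√π/2] + 8e^{−|y_{μ₀}|}·16/θ.
[cite: Balaban1983Higgs3, (3.16) p.437] -/
theorem integral_abs_integrand_succ_sub_three_le (hξ : 0 < ξ) (y : ZSite 3) (hy : y ≠ 0) (ν μ₀ : Fin 3)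
    (hmax : ∀ μ, (y μ).natAbs ≤ (y μ₀).natAbs) :
    ∫ t in Ioi (0 : ℝ), |integrand 3 ξ (y + unitVec ν) t - integrand 3 ξ y t| ≤
      Real.exp (-(ξ * Real.sqrt (rsq y) / 2)) *
          (10 * ((hopWeight 3 ξ)⁻¹ * (1 / (rsq y / 14)))
            + 64 / 7 * ((y ν).natAbs : ℝ) *
              ((hopWeight 3 ξ)⁻¹ * ((1 / (rsq y / 14)) ^ (3 / 2 : ℝ) * (Real.sqrt Real.pi / 2))))
        + 8 * Real.exp (-((y μ₀).natAbs : ℝ)) * (16 / hopWeight 3 ξ) := by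
  have hθ : 0 < hopWeight 3 ξ := theta3_pos hξ
  have hN1 : 1 ≤ ((y μ₀).natAbs : ℝ) := one_le_max y hy μ₀ hmax
  have hq : 0 < rsq y / 14 := by
    have h1 : (1 : ℝ) ≤ ((y μ₀).natAbs : ℝ) ^ 2 := by nlinarith
    linarith [sq_le_rsq y μ₀]
  obtain ⟨hgAint, hgAval⟩ := integral_rpow_neg_two_exp hq
  obtain ⟨hgBint, hgBval⟩ := integral_rpow_neg_five_halves_exp hq
  obtain ⟨hPint, hPval⟩ := integral_pref hθ
  set gA : ℝ → ℝ := fun u => u ^ (-(2 : ℝ)) * Real.exp (-(rsq y / 14) / u) with hgA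
  set gB : ℝ → ℝ := fun u => u ^ (-(5 / 2 : ℝ)) * Real.exp (-(rsq y / 14) / u) with hgB
  have hAint : IntegrableOn (fun t => gA (hopWeight 3 ξ * t)) (Ioi 0) := by
    have h := (integrableOn_Ioi_comp_mul_left_iff gA 0 hθ).mpr
    rw [mul_zero] at h
    exact h hgAint
  have hBint : IntegrableOn (fun t => gB (hopWeight 3 ξ * t)) (Ioi 0) := by
    have h := (integrableOn_Ioi_comp_mul_left_iff gB 0 hθ).mpr
    rw [mul_zero] at h
    exact h hgBint
  have hAval : ∫ t in Ioi (0 : ℝ), gA (hopWeight 3 ξ * t) = (hopWeight 3 ξ)⁻¹ * (1 / (rsq y / 14)) := by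
    have h := integral_comp_mul_left_Ioi gA 0 hθ
    rw [mul_zero, smul_eq_mul] at h
    rw [h, hgAval]
  have hBval : ∫ t in Ioi (0 : ℝ), gB (hopWeight 3 ξ * t) =
      (hopWeight 3 ξ)⁻¹ * ((1 / (rsq y / 14)) ^ (3 / 2 : ℝ) * (Real.sqrt Real.pi / 2)) := by
    have h := integral_comp_mul_left_Ioi gB 0 hθ
    rw [mul_zero, smul_eq_mul] at h
    rw [h, hgBval]
  set E1 : ℝ := Real.exp (-(ξ * Real.sqrt (rsq y) / 2)) with hE1
  set n : ℝ := ((y ν).natAbs : ℝ) with hn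
  set EN : ℝ := Real.exp (-((y μ₀).natAbs : ℝ)) with hEN
  have hpt : ∀ t ∈ Ioi (0 : ℝ), |integrand 3 ξ (y + unitVec ν) t - integrand 3 ξ y t| ≤
      E1 * (10 * gA (hopWeight 3 ξ * t) + 64 / 7 * n * gB (hopWeight 3 ξ * t))
        + 8 * EN * (2 / Real.sqrt (1 + hopWeight 3 ξ * t)) ^ 3 :=
    fun t ht => abs_integrand_succ_sub_three_le hξ y ν μ₀ hmax ht
  have hI1 : IntegrableOn (fun t => E1 * (10 * gA (hopWeight 3 ξ * t) + 64 / 7 * n * gB (hopWeight 3 ξ * t))) (Ioi 0) :=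
    Integrable.const_mul ((hAint.const_mul 10).add (hBint.const_mul (64 / 7 * n))) _
  have hI2 : IntegrableOn (fun t => 8 * EN * (2 / Real.sqrt (1 + hopWeight 3 ξ * t)) ^ 3) (Ioi 0) :=
    Integrable.const_mul hPint _
  have hLint : IntegrableOn (fun t => |integrand 3 ξ (y + unitVec ν) t - integrand 3 ξ y t|) (Ioi 0) :=
    ((integrableOn_integrand hξ (y + unitVec ν)).sub (integrableOn_integrand hξ y)).abs
  calc ∫ t in Ioi (0 : ℝ), |integrand 3 ξ (y + unitVec ν) t - integrand 3 ξ y t|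
      ≤ ∫ t in Ioi (0 : ℝ), (E1 * (10 * gA (hopWeight 3 ξ * t) + 64 / 7 * n * gB (hopWeight 3 ξ * t))
          + 8 * EN * (2 / Real.sqrt (1 + hopWeight 3 ξ * t)) ^ 3) :=
        setIntegral_mono_on hLint (hI1.add hI2) measurableSet_Ioi hpt
    _ = _ := by
        rw [integral_add hI1 hI2, integral_const_mul, integral_const_mul,
          integral_add (hAint.const_mul 10) (hBint.const_mul (64 / 7 * n)), integral_const_mul, integral_const_mul,
          hAval, hBval, hPval]

/-- kernel: √(14π) ≤ 7. [folklore] -/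
private theorem sqrt_fourteen_pi_le : Real.sqrt (14 * Real.pi) ≤ 7 :=
  calc Real.sqrt (14 * Real.pi) ≤ Real.sqrt (7 ^ 2) := Real.sqrt_le_sqrt (by nlinarith [Real.pi_lt_d2])
    _ = 7 := Real.sqrt_sq (by norm_num)

/-- kernel (the assembled difference bound with the two length scales kept apart): for 0 < ξ, 0 ≠ y ∈ ℤ³, μ₀ a largest
coordinate, R² = Σ_μ|y_μ|², R = √R², N = |y_{μ₀}|:
|C^ξ(y+e_ν) − C^ξ(y)| ≤ ξ^{−1}·[e^{−ξR/2}(140/R² + 448|y_ν|/(R·R²)) + 128e^{−N}]. [cite: Balaban1983Higgs3, (3.16) p.437] -/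
theorem abs_Cxi_succ_sub_three_le_aux (hξ : 0 < ξ) (y : ZSite 3) (hy : y ≠ 0) (ν μ₀ : Fin 3)
    (hmax : ∀ μ, (y μ).natAbs ≤ (y μ₀).natAbs) :
    |Cxi 3 ξ (y + unitVec ν) - Cxi 3 ξ y| ≤
      ξ⁻¹ * (Real.exp (-(ξ * Real.sqrt (rsq y) / 2)) *
          (140 / rsq y + 448 * ((y ν).natAbs : ℝ) / (Real.sqrt (rsq y) * rsq y))
        + 128 * Real.exp (-((y μ₀).natAbs : ℝ))) := by
  have hθ : 0 < hopWeight 3 ξ := theta3_pos hξ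
  have hθ' := hθ.ne'
  have hξ' := hξ.ne'
  have hN1 : 1 ≤ ((y μ₀).natAbs : ℝ) := one_le_max y hy μ₀ hmax
  have hrsq : 0 < rsq y := by nlinarith [sq_le_rsq y μ₀]
  have hRpos : 0 < Real.sqrt (rsq y) := Real.sqrt_pos.mpr hrsq
  have hR' := hRpos.ne'
  have hn : 0 ≤ ((y ν).natAbs : ℝ) := Nat.cast_nonneg _
  have hI := integral_abs_integrand_succ_sub_three_le hξ y hy ν μ₀ hmax
  -- |ΔC| = θξ²ξ⁻³·|∫ (f(y+e_ν) − f(y))| ≤ θξ²ξ⁻³·∫|…|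
  have hdiff : Cxi 3 ξ (y + unitVec ν) - Cxi 3 ξ y = hopWeight 3 ξ * ξ ^ 2 * ξ⁻¹ ^ 3 *
      ∫ t in Ioi (0 : ℝ), (integrand 3 ξ (y + unitVec ν) t - integrand 3 ξ y t) := by
    rw [Cxi_eq_poissonK hξ, Cxi_eq_poissonK hξ]
    unfold poissonK
    rw [integral_sub (integrableOn_integrand hξ _) (integrableOn_integrand hξ _)]
    ring
  have hc : 0 ≤ hopWeight 3 ξ * ξ ^ 2 * ξ⁻¹ ^ 3 := by positivity
  have habs : |Cxi 3 ξ (y + unitVec ν) - Cxi 3 ξ y| ≤ hopWeight 3 ξ * ξ ^ 2 * ξ⁻¹ ^ 3 *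
      ∫ t in Ioi (0 : ℝ), |integrand 3 ξ (y + unitVec ν) t - integrand 3 ξ y t| := by
    rw [hdiff, abs_mul, abs_of_nonneg hc]
    exact mul_le_mul_of_nonneg_left (abs_integral_le_integral_abs (μ := volume.restrict (Ioi (0 : ℝ)))
      (f := fun t => integrand 3 ξ (y + unitVec ν) t - integrand 3 ξ y t)) hc
  refine habs.trans ((mul_le_mul_of_nonneg_left hI hc).trans ?_)
  -- simplify the constants
  have hq14 : 1 / (rsq y / 14) = 14 / rsq y := by rw [one_div, inv_div]
  have hq32 : (14 / rsq y) ^ (3 / 2 : ℝ) = 14 / rsq y * (Real.sqrt 14 / Real.sqrt (rsq y)) := by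
    rw [show (3 / 2 : ℝ) = 1 + 1 / 2 by norm_num, Real.rpow_add (by positivity), Real.rpow_one,
      ← Real.sqrt_eq_rpow, Real.sqrt_div' _ (rsq_nonneg y)]
  have hsqpi : Real.sqrt 14 * Real.sqrt Real.pi ≤ 7 := by
    rw [← Real.sqrt_mul (by norm_num)]; exact sqrt_fourteen_pi_le
  rw [hq14, hq32]
  have e1 : hopWeight 3 ξ * ξ ^ 2 * ξ⁻¹ ^ 3 *
      (Real.exp (-(ξ * Real.sqrt (rsq y) / 2)) * (10 * ((hopWeight 3 ξ)⁻¹ * (14 / rsq y))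
        + 64 / 7 * ((y ν).natAbs : ℝ) *
          ((hopWeight 3 ξ)⁻¹ * (14 / rsq y * (Real.sqrt 14 / Real.sqrt (rsq y)) * (Real.sqrt Real.pi / 2))))
        + 8 * Real.exp (-((y μ₀).natAbs : ℝ)) * (16 / hopWeight 3 ξ))
      = ξ⁻¹ * (Real.exp (-(ξ * Real.sqrt (rsq y) / 2)) *
          (140 / rsq y + 64 * (Real.sqrt 14 * Real.sqrt Real.pi) * ((y ν).natAbs : ℝ) / (Real.sqrt (rsq y) * rsq y))
        + 128 * Real.exp (-((y μ₀).natAbs : ℝ))) := by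
    field_simp
    ring
  rw [e1]
  refine mul_le_mul_of_nonneg_left (add_le_add (mul_le_mul_of_nonneg_left (add_le_add le_rfl ?_) (Real.exp_pos _).le)
    le_rfl) (inv_pos.mpr hξ).le
  have hden : 0 < Real.sqrt (rsq y) * rsq y := mul_pos hRpos hrsq
  rw [div_le_div_iff_of_pos_right hden]
  nlinarith [hsqpi, hn]

/-- **The difference bound for C^ξ = (−Δ^ξ+1)^{−1} on ξℤ³, uniformly in the lattice spacing**: for 0 < ξ ≤ 1, 0 ≠ y ∈ ℤ³ and every
direction ν, |C^ξ(y+e_ν) − C^ξ(y)| ≤ 14400·ξ⁻¹·e^{−ξ|y|/2}/|y|², |y| = (Σ_μ y_μ²)^{1/2} (= ξ times the printed derivative bound).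
[cite: Balaban1983Higgs3, (3.16) p.437] -/
theorem abs_Cxi_succ_sub_three_le (hξ : 0 < ξ) (hξ1 : ξ ≤ 1) (y : ZSite 3) (hy : y ≠ 0) (ν : Fin 3) :
    |Cxi 3 ξ (y + unitVec ν) - Cxi 3 ξ y| ≤
      14400 * ξ⁻¹ * Real.exp (-(ξ * Real.sqrt (∑ μ, ((y μ : ℤ) : ℝ) ^ 2) / 2)) / ∑ μ, ((y μ : ℤ) : ℝ) ^ 2 := by
  obtain ⟨μ₀, -, hmax⟩ := Finset.exists_max_image Finset.univ (fun μ => (y μ).natAbs) Finset.univ_nonempty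
  have hmax' : ∀ μ, (y μ).natAbs ≤ (y μ₀).natAbs := fun μ => hmax μ (Finset.mem_univ μ)
  rw [← rsq_eq]
  have h := abs_Cxi_succ_sub_three_le_aux hξ y hy ν μ₀ hmax'
  have hR2 : Real.sqrt (rsq y) ^ 2 = rsq y := Real.sq_sqrt (rsq_nonneg y)
  set R := Real.sqrt (rsq y) with hRdef
  set N : ℝ := ((y μ₀).natAbs : ℝ) with hNdef
  set n : ℝ := ((y ν).natAbs : ℝ) with hndef
  have hN1 : 1 ≤ N := one_le_max y hy μ₀ hmax'
  have hrsq : 0 < rsq y := by nlinarith [sq_le_rsq y μ₀]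
  have hRpos : 0 < R := Real.sqrt_pos.mpr hrsq
  have hRle : rsq y ≤ 3 * N ^ 2 := by have := rsq_le y μ₀ hmax'; push_cast at this; linarith
  have h47 : 4 * R ≤ 7 * N := by
    have hsum : 0 < 4 * R + 7 * N := by linarith
    nlinarith [hsum, hR2, hRle, sq_nonneg N]
  have hnR : n ≤ R := by
    rw [hRdef]
    refine (Real.le_sqrt (Nat.cast_nonneg _) (rsq_nonneg y)).mpr ?_
    exact sq_le_rsq y ν
  refine h.trans ?_
  rw [← hR2]
  have hξinv : 0 < ξ⁻¹ := inv_pos.mpr hξ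
  -- 448 n/(R·R²) ≤ 448/R²
  have hB : 448 * n / (R * R ^ 2) ≤ 448 / R ^ 2 := by
    rw [div_le_div_iff₀ (by positivity) (by positivity)]
    nlinarith [hnR, hRpos]
  -- 128 e^{−N} ≤ 128·107·e^{−ξR/2}/R²
  have hC : 128 * Real.exp (-N) ≤ 128 * 107 * Real.exp (-(ξ * R / 2)) / R ^ 2 := by
    have e1 : Real.exp (-N) ≤ Real.exp (-(R / 2)) * Real.exp (-(R / 14)) := by
      rw [← Real.exp_add]; exact Real.exp_le_exp.mpr (by linarith [h47])
    have e2 := sq_mul_exp_neg_div_fourteen_le hRpos.le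
    have e3 : Real.exp (-(R / 2)) ≤ Real.exp (-(ξ * R / 2)) := Real.exp_le_exp.mpr (by nlinarith)
    rw [le_div_iff₀ (by positivity)]
    calc 128 * Real.exp (-N) * R ^ 2 ≤ 128 * (Real.exp (-(R / 2)) * Real.exp (-(R / 14))) * R ^ 2 := by
          gcongr
      _ = 128 * Real.exp (-(R / 2)) * (R ^ 2 * Real.exp (-(R / 14))) := by ring
      _ ≤ 128 * Real.exp (-(ξ * R / 2)) * 107 := by gcongr
      _ = 128 * 107 * Real.exp (-(ξ * R / 2)) := by ring
  have hE : 0 ≤ Real.exp (-(ξ * R / 2)) := (Real.exp_pos _).le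
  calc ξ⁻¹ * (Real.exp (-(ξ * R / 2)) * (140 / R ^ 2 + 448 * n / (R * R ^ 2)) + 128 * Real.exp (-N))
      ≤ ξ⁻¹ * (Real.exp (-(ξ * R / 2)) * (140 / R ^ 2 + 448 / R ^ 2) + 128 * 107 * Real.exp (-(ξ * R / 2)) / R ^ 2) := by
        gcongr
    _ = 14284 * ξ⁻¹ * Real.exp (-(ξ * R / 2)) / R ^ 2 := by ring
    _ ≤ 14400 * ξ⁻¹ * Real.exp (-(ξ * R / 2)) / R ^ 2 := by gcongr; norm_num

/-- **p. 437 — "the corresponding inequalities for derivatives" for the free propagator C^ξ on ξℤ³, uniformly in the lattice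
spacing**: for 0 < ξ ≤ 1, 0 ≠ y ∈ ℤ³ and every ν, |(∂^ξ_νC^ξ)(y)| ≤ 14400·e^{−ξ|y|/2}/(ξ|y|)², |y| = (Σ_μ y_μ²)^{1/2}, ξ|y| being the
physical distance of the paper (∂^ξ_ν = r15's `pdiffZ ξ⁻¹ ν`; compare the undifferentiated `B3CxiUniformBound.Cxi_three_le`:
C^ξ(y) ≤ 140·e^{−ξ|y|/2}/(ξ|y|)). [cite: Balaban1983Higgs3, (3.16) p.437] -/
theorem abs_pdiffZ_Cxi_three_le (hξ : 0 < ξ) (hξ1 : ξ ≤ 1) (y : ZSite 3) (hy : y ≠ 0) (ν : Fin 3) :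
    |pdiffZ ξ⁻¹ ν (Cxi 3 ξ) y| ≤
      14400 * Real.exp (-(ξ * Real.sqrt (∑ μ, ((y μ : ℤ) : ℝ) ^ 2) / 2))
        / (ξ * Real.sqrt (∑ μ, ((y μ : ℤ) : ℝ) ^ 2)) ^ 2 := by
  have h := abs_Cxi_succ_sub_three_le hξ hξ1 y hy ν
  have hR2 : Real.sqrt (∑ μ, ((y μ : ℤ) : ℝ) ^ 2) ^ 2 = ∑ μ, ((y μ : ℤ) : ℝ) ^ 2 :=
    Real.sq_sqrt (Finset.sum_nonneg fun μ _ => sq_nonneg _)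
  unfold pdiffZ
  rw [abs_mul, abs_of_pos (inv_pos.mpr hξ), mul_pow, hR2]
  have hξ' := hξ.ne'
  calc ξ⁻¹ * |Cxi 3 ξ (y + unitVec ν) - Cxi 3 ξ y|
      ≤ ξ⁻¹ * (14400 * ξ⁻¹ * Real.exp (-(ξ * Real.sqrt (∑ μ, ((y μ : ℤ) : ℝ) ^ 2) / 2)) / ∑ μ, ((y μ : ℤ) : ℝ) ^ 2) :=
        mul_le_mul_of_nonneg_left h (inv_pos.mpr hξ).le
    _ = _ := by field_simp

/-- kernel: the same bound for the backward derivative ∂^{ξ*}_ν (`pdiffAdjZ ξ⁻¹ ν`), by (∂^ξ_νC^ξ)(−y) = (∂^{ξ*}_νC^ξ)(y)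
(`pdiffZ_Cxi_neg`). [cite: Balaban1983Higgs3, (3.16) p.437] -/
theorem abs_pdiffAdjZ_Cxi_three_le (hξ : 0 < ξ) (hξ1 : ξ ≤ 1) (y : ZSite 3) (hy : y ≠ 0) (ν : Fin 3) :
    |pdiffAdjZ ξ⁻¹ ν (Cxi 3 ξ) y| ≤
      14400 * Real.exp (-(ξ * Real.sqrt (∑ μ, ((y μ : ℤ) : ℝ) ^ 2) / 2))
        / (ξ * Real.sqrt (∑ μ, ((y μ : ℤ) : ℝ) ^ 2)) ^ 2 := by
  rw [← pdiffZ_Cxi_neg]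
  have h := abs_pdiffZ_Cxi_three_le hξ hξ1 (-y) (neg_ne_zero.mpr hy) ν
  simpa only [Pi.neg_apply, Int.cast_neg, neg_sq] using h

/-- kernel: |y_μ| ≤ |y|_∞ in ℝ and 1 ≤ |y|_∞ for y ≠ 0, with a coordinate attaining the sup norm. [cite: Balaban1983Higgs3, (3.16) p.437] -/
theorem exists_supNorm_eq (y : ZSite d) (hd : 0 < d) : ∃ μ₀ : Fin d, supNorm y = (y μ₀).natAbs := by
  haveI : Nonempty (Fin d) := ⟨⟨0, hd⟩⟩
  obtain ⟨μ₀, -, hμ₀⟩ := Finset.exists_mem_eq_sup Finset.univ Finset.univ_nonempty (fun μ => (y μ).natAbs)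
  exact ⟨μ₀, hμ₀⟩

/-- kernel (the bound in the sup norm |y|_∞ = max_μ|y_μ|, the shape `B′·((ξ·supDist)²)⁻¹·e^{−δξ·supDist}` of `B3Bound316`'s hypothesis
`hM`, with B′ = 900, δ = ½): for 0 < ξ ≤ 1 and 0 ≠ y ∈ ℤ³,
|C^ξ(y+e_ν) − C^ξ(y)| ≤ 900·ξ⁻¹·e^{−ξ|y|_∞/2}/|y|_∞². [cite: Balaban1983Higgs3, (3.16) p.437] -/
theorem abs_Cxi_succ_sub_three_le_sup (hξ : 0 < ξ) (hξ1 : ξ ≤ 1) (y : ZSite 3) (hy : y ≠ 0) (ν : Fin 3) :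
    |Cxi 3 ξ (y + unitVec ν) - Cxi 3 ξ y| ≤
      900 * ξ⁻¹ * Real.exp (-(ξ * supNorm y / 2)) / (supNorm y : ℝ) ^ 2 := by
  obtain ⟨μ₀, hμ₀⟩ := exists_supNorm_eq y (by norm_num : 0 < 3)
  have hmax : ∀ μ, (y μ).natAbs ≤ (y μ₀).natAbs := fun μ => hμ₀ ▸ le_supNorm y μ
  have h := abs_Cxi_succ_sub_three_le_aux hξ y hy ν μ₀ hmax
  rw [hμ₀]
  have hR2 : Real.sqrt (rsq y) ^ 2 = rsq y := Real.sq_sqrt (rsq_nonneg y)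
  set R := Real.sqrt (rsq y) with hRdef
  set N : ℝ := ((y μ₀).natAbs : ℝ) with hNdef
  set n : ℝ := ((y ν).natAbs : ℝ) with hndef
  have hN1 : 1 ≤ N := one_le_max y hy μ₀ hmax
  have hrsq : 0 < rsq y := by nlinarith [sq_le_rsq y μ₀]
  have hRpos : 0 < R := Real.sqrt_pos.mpr hrsq
  have hNR : N ≤ R := by
    rw [hRdef]
    refine (Real.le_sqrt (by positivity) (rsq_nonneg y)).mpr ?_
    exact sq_le_rsq y μ₀
  have hnN : n ≤ N := by rw [hndef, hNdef]; exact_mod_cast hmax ν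
  have hN2 : N ^ 2 ≤ rsq y := sq_le_rsq y μ₀
  refine h.trans ?_
  have hξinv : 0 < ξ⁻¹ := inv_pos.mpr hξ
  have hE1 : Real.exp (-(ξ * R / 2)) ≤ Real.exp (-(ξ * N / 2)) := Real.exp_le_exp.mpr (by nlinarith)
  have hA : 140 / rsq y ≤ 140 / N ^ 2 := div_le_div_of_nonneg_left (by norm_num) (by positivity) hN2
  have hB : 448 * n / (R * rsq y) ≤ 448 / N ^ 2 := by
    rw [div_le_div_iff₀ (by positivity) (by positivity)]
    have : n * N ^ 2 ≤ R * rsq y := by nlinarith [hnN, hNR, hN2, hRpos]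
    nlinarith
  have hC : 128 * Real.exp (-N) ≤ 128 * 2.17 * Real.exp (-(ξ * N / 2)) / N ^ 2 := by
    have e1 : Real.exp (-N) = Real.exp (-(N / 2)) * Real.exp (-(N / 2)) := by rw [← Real.exp_add]; ring_nf
    have e2 := sq_mul_exp_neg_half_le (show (0 : ℝ) ≤ N by linarith)
    have e3 : Real.exp (-(N / 2)) ≤ Real.exp (-(ξ * N / 2)) := Real.exp_le_exp.mpr (by nlinarith)
    rw [le_div_iff₀ (by positivity), e1]
    calc 128 * (Real.exp (-(N / 2)) * Real.exp (-(N / 2))) * N ^ 2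
        = 128 * Real.exp (-(N / 2)) * (N ^ 2 * Real.exp (-(N / 2))) := by ring
      _ ≤ 128 * Real.exp (-(ξ * N / 2)) * 2.17 := by gcongr
      _ = 128 * 2.17 * Real.exp (-(ξ * N / 2)) := by ring
  have hE : 0 ≤ Real.exp (-(ξ * R / 2)) := (Real.exp_pos _).le
  have hsum0 : 0 ≤ 140 / N ^ 2 + 448 / N ^ 2 := by positivity
  calc ξ⁻¹ * (Real.exp (-(ξ * R / 2)) * (140 / rsq y + 448 * n / (R * rsq y)) + 128 * Real.exp (-N))
      ≤ ξ⁻¹ * (Real.exp (-(ξ * N / 2)) * (140 / N ^ 2 + 448 / N ^ 2) + 128 * 2.17 * Real.exp (-(ξ * N / 2)) / N ^ 2) := by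
        refine mul_le_mul_of_nonneg_left (add_le_add ?_ hC) hξinv.le
        exact mul_le_mul hE1 (add_le_add hA hB) (by positivity) (Real.exp_pos _).le
    _ = 865.76 * ξ⁻¹ * Real.exp (-(ξ * N / 2)) / N ^ 2 := by ring
    _ ≤ 900 * ξ⁻¹ * Real.exp (-(ξ * N / 2)) / N ^ 2 := by gcongr; norm_num

/-- **p. 437, derivative bound, sup-norm form**: for 0 < ξ ≤ 1, 0 ≠ y ∈ ℤ³ and every ν,
|(∂^ξ_νC^ξ)(y)| ≤ 900·e^{−ξ|y|_∞/2}/(ξ|y|_∞)² (compare `B3CxiUniformBound.Cxi_three_le_sup`: C^ξ(y) ≤ 140·e^{−ξ|y|_∞/2}/(ξ|y|_∞)).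
[cite: Balaban1983Higgs3, (3.16) p.437] -/
theorem abs_pdiffZ_Cxi_three_le_sup (hξ : 0 < ξ) (hξ1 : ξ ≤ 1) (y : ZSite 3) (hy : y ≠ 0) (ν : Fin 3) :
    |pdiffZ ξ⁻¹ ν (Cxi 3 ξ) y| ≤ 900 * Real.exp (-(ξ * supNorm y / 2)) / (ξ * supNorm y) ^ 2 := by
  have h := abs_Cxi_succ_sub_three_le_sup hξ hξ1 y hy ν
  unfold pdiffZ
  rw [abs_mul, abs_of_pos (inv_pos.mpr hξ), mul_pow]
  have hξ' := hξ.ne'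
  obtain ⟨μ₀, hμ₀⟩ := exists_supNorm_eq y (by norm_num : 0 < 3)
  have hmax : ∀ μ, (y μ).natAbs ≤ (y μ₀).natAbs := fun μ => hμ₀ ▸ le_supNorm y μ
  have hN1 : 1 ≤ ((supNorm y : ℕ) : ℝ) := by rw [hμ₀]; exact one_le_max y hy μ₀ hmax
  have hN' : ((supNorm y : ℕ) : ℝ) ≠ 0 := by linarith
  calc ξ⁻¹ * |Cxi 3 ξ (y + unitVec ν) - Cxi 3 ξ y|
      ≤ ξ⁻¹ * (900 * ξ⁻¹ * Real.exp (-(ξ * supNorm y / 2)) / (supNorm y : ℝ) ^ 2) :=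
        mul_le_mul_of_nonneg_left h (inv_pos.mpr hξ).le
    _ = _ := by field_simp

/-- kernel: sup-norm form for the backward derivative ∂^{ξ*}_ν. [cite: Balaban1983Higgs3, (3.16) p.437] -/
theorem abs_pdiffAdjZ_Cxi_three_le_sup (hξ : 0 < ξ) (hξ1 : ξ ≤ 1) (y : ZSite 3) (hy : y ≠ 0) (ν : Fin 3) :
    |pdiffAdjZ ξ⁻¹ ν (Cxi 3 ξ) y| ≤ 900 * Real.exp (-(ξ * supNorm y / 2)) / (ξ * supNorm y) ^ 2 := by
  rw [← pdiffZ_Cxi_neg]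
  have h := abs_pdiffZ_Cxi_three_le_sup hξ hξ1 (-y) (neg_ne_zero.mpr hy) ν
  have hsup : supNorm (-y) = supNorm y := by
    unfold supNorm; simp only [Pi.neg_apply, Int.natAbs_neg]
  rwa [hsup] at h

end

end Literature.MathematicalPhysics.QuantumFieldTheory.Balaban1983to89.B3CxiDerivativeBound
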